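import Mathlib

/-!
# BridgeEigenline — the eigenline model of the transfer: conjugate-equivariance and injectivity (Tier 4)

Seat p4 of the blind cell pub-hodge-repro2 (README §6, T4-A). `BridgeCore.BridgeData` asks of the
transfer `Λ : H^{20}(B,ℚ) → H⁴(B,ℚ)` two things beyond algebraicity: it commutes with the
`𝐅`-isotypic idempotent `e`, and it is injective on `e • V′`. route/LEAN-ANNEX-p4.md §3 verifies both
for the two candidate transfers (`L^{-8}`, and the Pontryagin product with four ample divisors) by an
eigenline computation: over `ℂ`, the (1,1,1,1)- and (5,5,5,5)-Künneth pieces have bases indexed by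
4-tuples `τ = (τ₁, …, τ₄)` of complex embeddings of `𝐅`, the Weil lines are spanned by the CONSTANT
tuples `(σ,σ,σ,σ)`, and both transfers send the basis vector of `τ` to a non-zero multiple of the basis
vector of `ρ ∘ τ`, `ρ` = complex conjugation (because the Riemann form of a CM abelian variety pairs
the `σ`-eigenline with the `σ̄`-eigenline only). This file kernel-checks the linear algebra of that
model: for any finite index set `G` with an involution `ρ` and non-zero scalars `c`,

* `transfer` (`(Λ v) τ = (∏ᵢ c (τ i)) • v (ρ ∘ τ)`) is linear, injective (`transfer_injective`),
* `weilProj` (the projection onto the span of the constant tuples) is an idempotent with range the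
  Weil subspace (`weilProj_apply_of_mem`, `weilProj_apply_mem`),
* `transfer` commutes with `weilProj` (`transfer_weilProj`): constant tuples go to constant tuples
  and non-constant ones to non-constant ones,

which are exactly the fields `e_smul_mem`, `e_smul_eq`, `transfer_e`, `transfer_inj` of `BridgeData`
in this model.
-/

namespace Summit.Ventures.HodgeRepro2.BridgeEigenline

variable {G : Type*} [Fintype G] [DecidableEq G] {n : ℕ}

/-- The model space: coefficient vectors on the eigenline basis indexed by `n`-tuples of embeddings. -/
abbrev Model (G : Type*) (n : ℕ) : Type _ := (Fin n → G) → ℂ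

/-- A tuple is constant (a Weil eigenline) iff all its entries agree with the first. -/
def IsConst (τ : Fin n → G) : Prop := ∀ i j, τ i = τ j

/-- Constancy of a tuple is decidable (finite conjunction of equalities in `G`). -/
instance instDecidableIsConst (τ : Fin n → G) : Decidable (IsConst τ) := by
  unfold IsConst; infer_instance

/-- The Weil subspace: vectors supported on the constant tuples. -/
def weil (G : Type*) [Fintype G] [DecidableEq G] (n : ℕ) : Submodule ℂ (Model G n) where
  carrier := {v | ∀ τ, ¬ IsConst τ → v τ = 0}
  add_mem' := fun {v w} hv hw τ hτ => by
    simp only [Pi.add_apply, hv τ hτ, hw τ hτ, add_zero]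
  zero_mem' := fun _ _ => rfl
  smul_mem' := fun c {v} hv τ hτ => by
    simp only [Pi.smul_apply, hv τ hτ, smul_zero]

/-- The isotypic projector onto the Weil subspace: keep the constant tuples, kill the others. -/
def weilProj (G : Type*) [Fintype G] [DecidableEq G] (n : ℕ) : Model G n →ₗ[ℂ] Model G n where
  toFun v τ := if IsConst τ then v τ else 0
  map_add' v w := by
    funext τ
    by_cases h : IsConst τ <;> simp [h]
  map_smul' a v := by
    funext τ
    by_cases h : IsConst τ <;> simp [h]

/-- `weilProj` lands in the Weil subspace. -/
theorem weilProj_apply_mem (v : Model G n) : weilProj G n v ∈ weil G n := by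
  intro τ hτ
  simp [weilProj, hτ]

/-- `weilProj` is the identity on the Weil subspace. -/
theorem weilProj_apply_of_mem {v : Model G n} (hv : v ∈ weil G n) : weilProj G n v = v := by
  funext τ
  by_cases h : IsConst τ
  · simp [weilProj, h]
  · simp [weilProj, h, hv τ h]

/-- `weilProj` is idempotent. -/
theorem weilProj_weilProj (v : Model G n) : weilProj G n (weilProj G n v) = weilProj G n v :=
  weilProj_apply_of_mem (weilProj_apply_mem v)

section Transfer

variable (ρ : G → G) (c : G → ℂ)

/-- The transfer in the eigenline model: the basis vector of `τ` goes to `(∏ᵢ c (τ i))` times the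
basis vector of `ρ ∘ τ`; on coefficient vectors, `(Λ v) τ = (∏ᵢ c (ρ (τ i))) • v (ρ ∘ τ)`. -/
def transfer : Model G n →ₗ[ℂ] Model G n where
  toFun v τ := (∏ i, c (ρ (τ i))) * v (ρ ∘ τ)
  map_add' v w := by
    funext τ
    simp [mul_add]
  map_smul' a v := by
    funext τ
    simp [mul_left_comm]

omit [Fintype G] [DecidableEq G] in
/-- Conjugation preserves constancy of tuples. -/
theorem isConst_comp_iff (hρ : Function.Involutive ρ) (τ : Fin n → G) :
    IsConst (ρ ∘ τ) ↔ IsConst τ := by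
  constructor
  · intro h i j
    exact hρ.injective (h i j)
  · intro h i j
    simp only [Function.comp_apply, h i j]

/-- **The transfer commutes with the isotypic projector** (the field `transfer_e` of `BridgeData`). -/
theorem transfer_weilProj (hρ : Function.Involutive ρ) (v : Model G n) :
    transfer ρ c (weilProj G n v) = weilProj G n (transfer ρ c v) := by
  funext τ
  simp only [transfer, weilProj, LinearMap.coe_mk, AddHom.coe_mk]
  by_cases h : IsConst τ
  · have h' : IsConst (ρ ∘ τ) := (isConst_comp_iff ρ hρ τ).2 h
    simp [h, h']
  · have h' : ¬ IsConst (ρ ∘ τ) := fun h' => h ((isConst_comp_iff ρ hρ τ).1 h')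
    simp [h, h']

omit [Fintype G] [DecidableEq G] in
/-- **The transfer is injective** when all scalars are non-zero (the field `transfer_inj`). -/
theorem transfer_injective (hρ : Function.Involutive ρ) (hc : ∀ σ, c σ ≠ 0) :
    Function.Injective (transfer (n := n) ρ c) := by
  intro v w hvw
  funext τ
  have h := congrFun hvw (ρ ∘ τ)
  simp only [transfer, LinearMap.coe_mk, AddHom.coe_mk] at h
  have hρτ : ρ ∘ (ρ ∘ τ) = τ := by
    funext i
    exact hρ (τ i)
  rw [hρτ] at h
  have hprod : (∏ i, c (ρ ((ρ ∘ τ) i))) ≠ 0 := Finset.prod_ne_zero_iff.2 (fun i _ => hc _)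
  exact mul_left_cancel₀ hprod h

/-- The transfer maps the Weil subspace into itself. -/
theorem transfer_mem_weil (hρ : Function.Involutive ρ) {v : Model G n} (hv : v ∈ weil G n) :
    transfer ρ c v ∈ weil G n := by
  rw [← weilProj_apply_of_mem hv, transfer_weilProj ρ c hρ]
  exact weilProj_apply_mem _

end Transfer

end Summit.Ventures.HodgeRepro2.BridgeEigenline
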